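import Summits.HodgeConjecture.CorCM.AbelianSixteenSquaresInConj
import Summits.HodgeConjecture.CorCM.Model.CMAbelianVarietyRealisedHolds
import Literature.AlgebraicGeometry.ComplexMultiplication.ShimuraIsogenousPowerOfRiemann
import Mathlib.Data.ZMod.QuotientGroup
import HarnessLib

/-!
# Non-vacuity: abelian CM fields of degree `16` of the three "good" Galois types (`ℤ/8 × ℤ/2` with `c` in the cyclic
# factor, `(ℤ/2)⁴`, `ℤ/4 × (ℤ/2)²` with `c` a square) DO carry simple CM abelian eightfolds — all nondegenerate

COR-CM (cell `pub-hodgecm2`), binder seat b04 (gen 15), count-neutral claim ABELIAN-2POWER-CLASSIF, part V.  KERNEL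
ONLY: theorems; no definition, no named fact, no `sorry`.  `HC_CM` is neither used nor claimed.

Parts Ib/IIc prove: for an abelian CM field `K` of degree `16` which is cyclic over `ℚ` or a real quadratic field, or
all of whose Galois automorphisms square to `1` or to complex conjugation, EVERY SIMPLE CM abelian eightfold with CM by
`K` is nondegenerate (Hodge conjecture for all its powers).  This file certifies that the statement is NOT VACUOUS: such
fields have PRIMITIVE CM types (a kernel-decided model per Galois type), hence — by the existence of abelian varieties of
prescribed CM type (Shimura §6.2 Thm. 3, the tree theorem `CorCM.cmAbelianVarietyRealised_holds`) and Shimura's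
"`A` simple ⟺ `Φ` primitive" (`isSimple_iff_isPrimitive`) — simple CM eightfolds with CM by `K`, all nondegenerate.

* §1 **`exists_isPrimitive_of_galoisModel`** — GENERIC: an isomorphism `e : Gal(K/ℚ) ≃ M` with an additive group
  `M` sending complex conjugation to `c₀`, and a model `T₀ ⊆ M` which is a CM set for `c₀` with trivial stabiliser,
  give a PRIMITIVE CM type `Φ = {σ_g : e(g) ∈ T₀}` (the `Aut(ℂ)`-translates act through `x ↦ x − d`).
* §2 models (by `decide`): `{(0,0),(1,0),(1,1),(2,0),(2,1),(3,0),(3,1),(4,1)} ⊆ ℤ/8 × ℤ/2` for `c₀ = (4,0)`; the type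
  of the cubic Boolean function `x₂x₃x₄` on `(ℤ/2)⁴` for `c₀ = e₁`; `{(0,0,0),(0,1,0),(0,1,1),(1,0,0),(1,0,1),(1,1,0),
  (1,1,1),(2,0,1)} ⊆ ℤ/4 × (ℤ/2)²` for `c₀ = (2,0,0)`.
* §3 **`exists_simple_nondegenerate_of_equiv_zmod8_prod_zmod2`**, **`…_of_equiv_zmod2_pow_four`**,
  **`…_of_equiv_zmod4_prod_zmod2_sq`**: for `K` CM, Galois of degree `16` with `Gal(K/ℚ)` of the stated type (and
  `c ↦ c₀`), there EXIST a CM type `Φ` and a SIMPLE abelian eightfold `(A, ι, θ)` of type `(K; Φ)`, and every such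
  `Φ` is NONDEGENERATE (parts Ia/IIc).  E.g. `ℚ(ζ₃₂ − ζ₃₂⁻¹, √3)`, `ℚ(√−1, √2, √3, √5)`, `ℚ(ζ₅, √2, √3)`.

(The offline census of this seat counts `224`, `128`, `192` primitive types for the three pairs.)

## References

* [Shimura1998] G. Shimura, *Abelian Varieties with Complex Multiplication and Modular Functions*, §6.2 Thm. 3,
  §8.1, §8.2 Prop. 26, §18.2 Lemma.
* [Kubota1965] T. Kubota, *On the field extension by complex multiplication*, Trans. AMS 118 (1965), §4 Lemma 2.
-/

noncomputable section

open CategoryTheory CategoryTheory.Limits NumberField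

namespace Summit.HodgeConjecture.CorCM.AbelianSixteen

open Literature.NumberTheory.ComplexMultiplication
open Literature.AlgebraicGeometry.Motives (AbelianVariety CMType)
open Literature.AlgebraicGeometry.HodgeTheory
open Literature.AlgebraicGeometry.ComplexMultiplication (IsCMTypeRealisation isSimple_iff_isPrimitive
  exists_isCMTypeRealisation_of_realised)
open Literature.AlgebraicGeometry.Pohlmann1968
open Summit.HodgeConjecture.CorCM.GaloisOctic (embOf_complexConj_mul)
open Summit.HodgeConjecture.CorCM.ThinKernel (isNondegenerate_of_isPrimitive_of_mem_zpowers)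

open scoped Classical

variable {K : Type} [Field K] [NumberField K] [IsCMField K]

/-! ## §1 Galois models ⟹ primitive CM types -/

/-- **A model with trivial stabiliser on `Gal(K/ℚ) ≃ M` gives a PRIMITIVE CM type.**  For `K/ℚ` normal CM, an
isomorphism `e` of `Gal(K/ℚ)` with (the multiplicative version of) an additive group `M` carrying complex conjugation
to `c₀`, and `T₀ ⊆ M` with `x ∈ T₀ ↔ c₀ + x ∉ T₀` (CM set) and `∀ v ≠ 0 ∃ w, ¬(w ∈ T₀ ↔ v + w ∈ T₀)` (trivial
stabiliser): `Φ = {σ_g : e(g) ∈ T₀}` (`σ_g = φ₀ ∘ g⁻¹`) is a primitive CM type. [cite: Shimura1998, §8.1, §8.2 Prop. 26,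
§18.2 Lemma (i)] -/
theorem exists_isPrimitive_of_galoisModel [Normal ℚ K] {M : Type*} [AddCommGroup M]
    (e : (K ≃ₐ[ℚ] K) ≃* Multiplicative M) (c₀ : M)
    (hc : e ((IsCMField.complexConj K).restrictScalars ℚ) = Multiplicative.ofAdd c₀) (T₀ : Finset M)
    (hcm : ∀ x : M, x ∈ T₀ ↔ c₀ + x ∉ T₀) (hprim : ∀ v : M, v ≠ 0 → ∃ w : M, ¬ (w ∈ T₀ ↔ v + w ∈ T₀))
    (φ₀ : K →+* ℂ) :
    ∃ Φ : CMType K, IsPrimitive (ℂ ≃+* ℂ) Φ.1 φ₀ ∧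
      ∀ g : K ≃ₐ[ℚ] K, embOf φ₀ g ∈ Φ.1 ↔ Multiplicative.toAdd (e g) ∈ T₀ := by
  haveI := isPretransitive_ringEquiv_complex (K := K)
  set c : K ≃ₐ[ℚ] K := (IsCMField.complexConj K).restrictScalars ℚ with hc_def
  -- the parametrisation `ψ x = e⁻¹ x`
  set ψ : M → (K ≃ₐ[ℚ] K) := fun x => e.symm (Multiplicative.ofAdd x) with hψ_def
  have hψadd : ∀ x y, ψ (x + y) = ψ x * ψ y := fun x y => by
    simp only [hψ_def, ofAdd_add, map_mul]
  have hψneg : ∀ x, ψ (-x) = (ψ x)⁻¹ := fun x => by simp only [hψ_def, ofAdd_neg, map_inv]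
  have hψc : ψ c₀ = c := by rw [hψ_def]; simp only; rw [← hc, MulEquiv.symm_apply_apply]
  have hψe : ∀ g, ψ (Multiplicative.toAdd (e g)) = g := fun g => by
    simp only [hψ_def, ofAdd_toAdd, MulEquiv.symm_apply_apply]
  have heψ : ∀ x, Multiplicative.toAdd (e (ψ x)) = x := fun x => by
    simp only [hψ_def, MulEquiv.apply_symm_apply, toAdd_ofAdd]
  have hψinj : Function.Injective ψ := fun x y h => by
    have := congrArg (fun g => Multiplicative.toAdd (e g)) h
    simpa only [heψ] using this
  -- the embeddings `E x = σ_{ψ x}`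
  set E : M → (K →+* ℂ) := fun x => embOf φ₀ (ψ x) with hE_def
  have hEinj : Function.Injective E := fun x y hxy => hψinj ((embOf_bijective φ₀).1 hxy)
  have hEsurj : ∀ φ : K →+* ℂ, ∃ x, E x = φ := fun φ => by
    obtain ⟨g, rfl⟩ := (embOf_bijective φ₀).2 φ
    exact ⟨Multiplicative.toAdd (e g), by simp only [hE_def, hψe]⟩
  have hEconj : ∀ x, ComplexEmbedding.conjugate (E x) = E (c₀ + x) := fun x => by
    show ComplexEmbedding.conjugate (embOf φ₀ (ψ x)) = embOf φ₀ (ψ (c₀ + x))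
    rw [hψadd, hψc, embOf_complexConj_mul]
  have hEsmul : ∀ (x d : M) {τ : ℂ ≃+* ℂ}, (∀ a, τ (φ₀ a) = φ₀ (ψ d a)) → τ • E x = E (x - d) := by
    intro x d τ hτ
    show τ • embOf φ₀ (ψ x) = embOf φ₀ (ψ (x - d))
    rw [smul_embOf_of_comp φ₀ hτ, sub_eq_add_neg, hψadd, hψneg]
  -- the CM type
  set S : Set (K →+* ℂ) := E '' (T₀ : Set M) with hS_def
  have hmemE : ∀ x, E x ∈ S ↔ x ∈ T₀ := fun x => by rw [hS_def, hEinj.mem_set_image, Finset.mem_coe]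
  have hcm' : ∀ φ, φ ∈ S ↔ ComplexEmbedding.conjugate φ ∉ S := by
    intro φ
    obtain ⟨x, rfl⟩ := hEsurj φ
    rw [hEconj, hmemE, hmemE]
    exact hcm x
  let Φ : CMType K := ⟨S, hcm'⟩
  refine ⟨Φ, ?_, fun g => ?_⟩
  · rw [isPrimitive_iff_forall_eq]
    intro φ₁ φ₂ hsep
    obtain ⟨x₁, rfl⟩ := hEsurj φ₁
    obtain ⟨x₂, rfl⟩ := hEsurj φ₂
    by_contra hne
    have hv : x₂ - x₁ ≠ 0 := fun h => hne (by rw [sub_eq_zero] at h; rw [h])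
    obtain ⟨w, hw⟩ := hprim (x₂ - x₁) hv
    obtain ⟨τ, hτ⟩ := exists_ringEquiv_comp_eq_algEquiv φ₀ (ψ (x₁ - w))
    have h := hsep τ
    rw [hEsmul x₁ (x₁ - w) hτ, hEsmul x₂ (x₁ - w) hτ, sub_sub_cancel,
      show x₂ - (x₁ - w) = x₂ - x₁ + w by abel] at h
    exact hw ((hmemE w).symm.trans (h.trans (hmemE _)))
  · have hg : embOf φ₀ g = E (Multiplicative.toAdd (e g)) := by simp only [hE_def, hψe]
    change embOf φ₀ g ∈ S ↔ _
    rw [hg]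
    exact hmemE _

omit [IsCMField K] in
/-- The Galois group is commutative when it is isomorphic to (the multiplicative version of) an additive commutative
group. [folklore] -/
theorem comm_of_equiv {M : Type*} [AddCommGroup M] (e : (K ≃ₐ[ℚ] K) ≃* Multiplicative M) (g h : K ≃ₐ[ℚ] K) :
    g * h = h * g :=
  e.injective (by rw [map_mul, map_mul, mul_comm])

omit [IsCMField K] in
/-- `[K:ℚ] = |M|` along `e : Gal(K/ℚ) ≃ M` (`K/ℚ` Galois). [folklore] -/
theorem finrank_eq_card_of_equiv [IsGalois ℚ K] {M : Type*} [AddCommGroup M] [Fintype M]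
    (e : (K ≃ₐ[ℚ] K) ≃* Multiplicative M) : Module.finrank ℚ K = Fintype.card M := by
  rw [← IsGalois.card_aut_eq_finrank, Nat.card_congr e.toEquiv, Nat.card_eq_fintype_card, Fintype.card_multiplicative]

/-! ## §2 The three models (kernel-decided) -/

namespace Models

/-- CM set for `(4,0)` in `ℤ/8 × ℤ/2`. [folklore] -/
theorem cm82 : ∀ x : ZMod 8 × ZMod 2,
    x ∈ ({(0,0), (1,0), (1,1), (2,0), (2,1), (3,0), (3,1), (4,1)} : Finset (ZMod 8 × ZMod 2)) ↔
      (4, 0) + x ∉ ({(0,0), (1,0), (1,1), (2,0), (2,1), (3,0), (3,1), (4,1)} : Finset (ZMod 8 × ZMod 2)) := by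
  decide

/-- Trivial stabiliser in `ℤ/8 × ℤ/2`. [folklore] -/
theorem prim82 : ∀ v : ZMod 8 × ZMod 2, v ≠ 0 → ∃ w : ZMod 8 × ZMod 2,
    ¬ (w ∈ ({(0,0), (1,0), (1,1), (2,0), (2,1), (3,0), (3,1), (4,1)} : Finset (ZMod 8 × ZMod 2)) ↔
      v + w ∈ ({(0,0), (1,0), (1,1), (2,0), (2,1), (3,0), (3,1), (4,1)} : Finset (ZMod 8 × ZMod 2))) := by
  decide

/-- CM set for `e₁ = (1,0,0,0)` in `(ℤ/2)⁴`: the type of the cubic Boolean function `x₂x₃x₄`. [folklore] -/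
theorem cm2222 : ∀ x : ZMod 2 × ZMod 2 × ZMod 2 × ZMod 2,
    x ∈ ({(0,0,0,0), (0,0,1,0), (0,0,1,1), (0,1,0,0), (0,1,0,1), (0,1,1,0), (0,1,1,1), (1,0,0,1)} :
      Finset (ZMod 2 × ZMod 2 × ZMod 2 × ZMod 2)) ↔
      (1, 0, 0, 0) + x ∉ ({(0,0,0,0), (0,0,1,0), (0,0,1,1), (0,1,0,0), (0,1,0,1), (0,1,1,0), (0,1,1,1), (1,0,0,1)} :
      Finset (ZMod 2 × ZMod 2 × ZMod 2 × ZMod 2)) := by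
  decide

/-- Trivial stabiliser in `(ℤ/2)⁴` (all derivatives of `x₂x₃x₄` are non-constant). [folklore] -/
theorem prim2222 : ∀ v : ZMod 2 × ZMod 2 × ZMod 2 × ZMod 2, v ≠ 0 → ∃ w : ZMod 2 × ZMod 2 × ZMod 2 × ZMod 2,
    ¬ (w ∈ ({(0,0,0,0), (0,0,1,0), (0,0,1,1), (0,1,0,0), (0,1,0,1), (0,1,1,0), (0,1,1,1), (1,0,0,1)} :
      Finset (ZMod 2 × ZMod 2 × ZMod 2 × ZMod 2)) ↔
      v + w ∈ ({(0,0,0,0), (0,0,1,0), (0,0,1,1), (0,1,0,0), (0,1,0,1), (0,1,1,0), (0,1,1,1), (1,0,0,1)} :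
      Finset (ZMod 2 × ZMod 2 × ZMod 2 × ZMod 2))) := by
  decide

/-- CM set for `(2,0,0)` in `ℤ/4 × (ℤ/2)²`. [folklore] -/
theorem cm422 : ∀ x : ZMod 4 × ZMod 2 × ZMod 2,
    x ∈ ({(0,0,0), (0,1,0), (0,1,1), (1,0,0), (1,0,1), (1,1,0), (1,1,1), (2,0,1)} :
      Finset (ZMod 4 × ZMod 2 × ZMod 2)) ↔
      (2, 0, 0) + x ∉ ({(0,0,0), (0,1,0), (0,1,1), (1,0,0), (1,0,1), (1,1,0), (1,1,1), (2,0,1)} :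
      Finset (ZMod 4 × ZMod 2 × ZMod 2)) := by
  decide

/-- Trivial stabiliser in `ℤ/4 × (ℤ/2)²`. [folklore] -/
theorem prim422 : ∀ v : ZMod 4 × ZMod 2 × ZMod 2, v ≠ 0 → ∃ w : ZMod 4 × ZMod 2 × ZMod 2,
    ¬ (w ∈ ({(0,0,0), (0,1,0), (0,1,1), (1,0,0), (1,0,1), (1,1,0), (1,1,1), (2,0,1)} :
      Finset (ZMod 4 × ZMod 2 × ZMod 2)) ↔
      v + w ∈ ({(0,0,0), (0,1,0), (0,1,1), (1,0,0), (1,0,1), (1,1,0), (1,1,1), (2,0,1)} :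
      Finset (ZMod 4 × ZMod 2 × ZMod 2))) := by
  decide

/-- Squares in `(ℤ/2)⁴` vanish. [folklore] -/
theorem two_smul_2222 : ∀ x : ZMod 2 × ZMod 2 × ZMod 2 × ZMod 2, x + x = 0 := by decide

/-- Doubles in `ℤ/4 × (ℤ/2)²` are `0` or `(2,0,0)`. [folklore] -/
theorem two_smul_422 : ∀ x : ZMod 4 × ZMod 2 × ZMod 2, x + x = 0 ∨ x + x = (2, 0, 0) := by decide

end Models

/-! ## §3 Simple nondegenerate CM eightfolds exist for the three good Galois types of degree `16` -/

section Exist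

variable [IsGalois ℚ K]

omit [IsGalois ℚ K] in
/-- Realise a primitive type by a simple abelian variety of dimension `[K:ℚ]/2` (Shimura §6.2 Thm. 3 via the tree
theorem `cmAbelianVarietyRealised_holds`, and §8.2 Prop. 26). [cite: Shimura1998, §6.2 Thm. 3 and §8.2 Prop. 26] -/
theorem exists_simple_realisation_of_isPrimitive (Φ : CMType K) (φ₀ : K →+* ℂ)
    (hprim : IsPrimitive (ℂ ≃+* ℂ) Φ.1 φ₀) :
    ∃ (A : AbelianVariety ℂ) (ι : 𝓞 K →+* End A) (θ : K →+* Module.End ℂ (complexBetti A.X 1)),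
      IsCMTypeRealisation Φ A ι θ ∧ A.IsSimple ∧ A.dim = Module.finrank ℚ K / 2 := by
  obtain ⟨A, ι, θ, hA⟩ := exists_isCMTypeRealisation_of_realised cmAbelianVarietyRealised_holds K Φ
  exact ⟨A, ι, θ, hA, (isSimple_iff_isPrimitive hA φ₀).2 hprim,
    Literature.AlgebraicGeometry.Motives.schemeDim_eq_holds hA.1⟩

/-- **`Gal(K/ℚ) ≅ ℤ/8 × ℤ/2` with complex conjugation `(4,0)` (in the cyclic factor; e.g. `ℚ(ζ₃₂ − ζ₃₂⁻¹, √3)`):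
simple CM eightfolds with CM by `K` EXIST, and every one of them is NONDEGENERATE** (part Ia, thin kernels: `c = z⁴`
for `z ↦ (1,0)` generating a cyclic subgroup of index `2`). [cite: Shimura1998, §6.2 Thm. 3 and §8.2 Prop. 26]
[cite: Kubota1965, §4 Lemma 2] -/
theorem exists_simple_nondegenerate_of_equiv_zmod8_prod_zmod2
    (e : (K ≃ₐ[ℚ] K) ≃* Multiplicative (ZMod 8 × ZMod 2))
    (hc : e ((IsCMField.complexConj K).restrictScalars ℚ) = Multiplicative.ofAdd (4, 0)) (φ₀ : K →+* ℂ) :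
    (∃ (Φ : CMType K) (A : AbelianVariety ℂ) (ι : 𝓞 K →+* End A) (θ : K →+* Module.End ℂ (complexBetti A.X 1)),
        IsCMTypeRealisation Φ A ι θ ∧ A.IsSimple ∧ A.dim = 8) ∧
      ∀ Φ : CMType K, IsPrimitive (ℂ ≃+* ℂ) Φ.1 φ₀ → IsNondegenerate Φ := by
  have hK : Module.finrank ℚ K = 2 ^ (3 + 1) := by
    rw [finrank_eq_card_of_equiv e]; simp [ZMod.card]
  refine ⟨?_, fun Φ hprim => ?_⟩
  · obtain ⟨Φ, hprim, -⟩ := exists_isPrimitive_of_galoisModel e (4, 0) hc _ Models.cm82 Models.prim82 φ₀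
    obtain ⟨A, ι, θ, hA, hs, hdim⟩ := exists_simple_realisation_of_isPrimitive Φ φ₀ hprim
    exact ⟨Φ, A, ι, θ, hA, hs, by norm_num [hdim, hK]⟩
  · -- `z ↦ (1,0)`: `c = z⁴ ∈ ⟨z⟩`, `⟨z⟩` of order `8` and index `2`
    set z : K ≃ₐ[ℚ] K := e.symm (Multiplicative.ofAdd (1, 0)) with hz
    have hez : e z = Multiplicative.ofAdd (1, 0) := by rw [hz, MulEquiv.apply_symm_apply]
    have hcz : (IsCMField.complexConj K).restrictScalars ℚ ∈ Subgroup.zpowers z := by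
      have h40 : (4 : ℕ) • ((1, 0) : ZMod 8 × ZMod 2) = (4, 0) := by decide
      have h4 : (IsCMField.complexConj K).restrictScalars ℚ = z ^ 4 := e.injective (by
        rw [hc, map_pow, hez, ← ofAdd_nsmul, h40])
      rw [h4]; exact Subgroup.pow_mem _ (Subgroup.mem_zpowers z) 4
    have hoz : orderOf z = 8 := by
      rw [← e.orderOf_eq z, hez, orderOf_ofAdd_eq_addOrderOf, Prod.addOrderOf]
      simp [ZMod.addOrderOf_one]
    have hidx : (Subgroup.zpowers z).index ≤ 2 := by
      have h := (Subgroup.zpowers z).index_mul_card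
      rw [Nat.card_zpowers, hoz, IsGalois.card_aut_eq_finrank, hK] at h
      omega
    exact isNondegenerate_of_isPrimitive_of_mem_zpowers (comm_of_equiv e) hK z hcz hidx φ₀ hprim

/-- **`Gal(K/ℚ) ≅ (ℤ/2)⁴` (multiquadratic CM fields of degree `16`, e.g. `ℚ(√−1, √2, √3, √5)`): simple CM
eightfolds with CM by `K` EXIST, and every one of them is NONDEGENERATE** (part IIc). [cite: Shimura1998, §6.2 Thm. 3
and §8.2 Prop. 26] [cite: Kubota1965, §4 Lemma 2] -/
theorem exists_simple_nondegenerate_of_equiv_zmod2_pow_four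
    (e : (K ≃ₐ[ℚ] K) ≃* Multiplicative (ZMod 2 × ZMod 2 × ZMod 2 × ZMod 2))
    (hc : e ((IsCMField.complexConj K).restrictScalars ℚ) = Multiplicative.ofAdd (1, 0, 0, 0)) (φ₀ : K →+* ℂ) :
    (∃ (Φ : CMType K) (A : AbelianVariety ℂ) (ι : 𝓞 K →+* End A) (θ : K →+* Module.End ℂ (complexBetti A.X 1)),
        IsCMTypeRealisation Φ A ι θ ∧ A.IsSimple ∧ A.dim = 8) ∧
      ∀ Φ : CMType K, IsPrimitive (ℂ ≃+* ℂ) Φ.1 φ₀ → IsNondegenerate Φ := by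
  have hK : Module.finrank ℚ K = 16 := by rw [finrank_eq_card_of_equiv e]; simp [ZMod.card]
  refine ⟨?_, fun Φ hprim => ?_⟩
  · obtain ⟨Φ, hprim, -⟩ := exists_isPrimitive_of_galoisModel e (1, 0, 0, 0) hc _ Models.cm2222 Models.prim2222 φ₀
    obtain ⟨A, ι, θ, hA, hs, hdim⟩ := exists_simple_realisation_of_isPrimitive Φ φ₀ hprim
    exact ⟨Φ, A, ι, θ, hA, hs, by rw [hdim, hK]⟩
  · have hsq : ∀ g : K ≃ₐ[ℚ] K, g * g = 1 := fun g => e.injective (by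
      rw [map_mul, map_one, ← ofAdd_toAdd (e g), ← ofAdd_add, Models.two_smul_2222, ofAdd_zero])
    exact isNondegenerate_of_isPrimitive_of_sq_eq_one hK hsq φ₀ hprim

/-- **`Gal(K/ℚ) ≅ ℤ/4 × (ℤ/2)²` with complex conjugation `(2,0,0)` (a square; `K` = cyclic quartic CM field times a
real biquadratic field, e.g. `ℚ(ζ₅, √2, √3)`): simple CM eightfolds with CM by `K` EXIST, and every one of them is
NONDEGENERATE** (part IIc). [cite: Shimura1998, §6.2 Thm. 3 and §8.2 Prop. 26] [cite: Kubota1965, §4 Lemma 2] -/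
theorem exists_simple_nondegenerate_of_equiv_zmod4_prod_zmod2_sq
    (e : (K ≃ₐ[ℚ] K) ≃* Multiplicative (ZMod 4 × ZMod 2 × ZMod 2))
    (hc : e ((IsCMField.complexConj K).restrictScalars ℚ) = Multiplicative.ofAdd (2, 0, 0)) (φ₀ : K →+* ℂ) :
    (∃ (Φ : CMType K) (A : AbelianVariety ℂ) (ι : 𝓞 K →+* End A) (θ : K →+* Module.End ℂ (complexBetti A.X 1)),
        IsCMTypeRealisation Φ A ι θ ∧ A.IsSimple ∧ A.dim = 8) ∧
      ∀ Φ : CMType K, IsPrimitive (ℂ ≃+* ℂ) Φ.1 φ₀ → IsNondegenerate Φ := by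
  have hK : Module.finrank ℚ K = 16 := by rw [finrank_eq_card_of_equiv e]; simp [ZMod.card]
  refine ⟨?_, fun Φ hprim => ?_⟩
  · obtain ⟨Φ, hprim, -⟩ := exists_isPrimitive_of_galoisModel e (2, 0, 0) hc _ Models.cm422 Models.prim422 φ₀
    obtain ⟨A, ι, θ, hA, hs, hdim⟩ := exists_simple_realisation_of_isPrimitive Φ φ₀ hprim
    exact ⟨Φ, A, ι, θ, hA, hs, by rw [hdim, hK]⟩
  · have hsq : ∀ g : K ≃ₐ[ℚ] K, g * g = 1 ∨ g * g = (IsCMField.complexConj K).restrictScalars ℚ := by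
      intro g
      rcases Models.two_smul_422 (Multiplicative.toAdd (e g)) with h | h
      · left
        exact e.injective (by rw [map_mul, map_one, ← ofAdd_toAdd (e g), ← ofAdd_add, h, ofAdd_zero])
      · right
        exact e.injective (by rw [map_mul, hc, ← ofAdd_toAdd (e g), ← ofAdd_add, h])
    exact isNondegenerate_of_isPrimitive_of_sq_eq_one_or_conj (comm_of_equiv e) hK hsq φ₀ hprim

end Exist

end Summit.HodgeConjecture.CorCM.AbelianSixteen

end
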